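import Literature.AlgebraicGeometry.AbelianSchemes.PDivisibleGroupRingAction
import Literature.AlgebraicGeometry.GroupSchemes.BTGroupBlock
import Literature.AlgebraicGeometry.GroupSchemes.BTGroupBlockIdealTorsion
import Literature.RingTheory.DedekindDomain.BlockIdempotentFamily
import HarnessLib

/-!
# The `w`-block docking package of an abelian scheme with a ring action, in `A`-currency
# ([Tate 1967] §2; [Rapoport–Smithling–Zhang 2020] §4.1; [Harris–Taylor 2001] §II.1; [Liu 2021] App. D p. 136)

Topic `Literature/AlgebraicGeometry/AbelianSchemes`; namespaces `Literature.AlgebraicGeometry.AbelianSchemes.AbelianSchemeOver.RingAction` (§1,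
§3, §4) and `Literature.AlgebraicGeometry.GroupSchemes.IsRingActionBT` (§2, any Barsotti–Tate group with a ring action).  THEOREMS ONLY (no
definition, no named fact, no instance, no notation, no `sorry`).  Cell `hodgecm-mathlib` (D-0151), FLOOR 0, P6 «MOD programme» (crux hLiu418 =
stmt-HodgeConjecture-24832, `--supports`, count-neutral): K∕BT desk F0P6d-plan (g2), K∕BT CUT v2.3 organ **(O-DOCK) «w-BLOCK DOCKING PACKAGE IN
A-CURRENCY»** (memo `F0/P6/F0P6d-plan/KBT-CUT.v2p3.F0P6dplan-g2.md`).  P6a's Defs v0.5 (R-1) carries, per special point `x̄`, the block carrier `G₀ x̄`,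
its embedding and kernel-of-`𝔭` universal property, the `O`-action on it and the K-HYP numerics as FIELDS; GEN discharges them ONCE, by name, for any
abelian scheme `A` over a field with an `O`-action: this file assembles, from ★ (O-CRT) `BlockIdempotentFamily` (the CRT family `a` at `w ∣ p`), ★ DEAL 3
`PDivisibleGroupRingAction` (`β r := (act.i r)[p^∞]`), ★ (O-LOC) `BTGroupBlock` (the localised action on the block) and ★ (O-J)
`BTGroupBlockIdealTorsion` (ideal torsion = uniformizer kernel), the one `∃`-package GEN plugs into the ★ P6b kit `blockNumerics_of_line` (its sockets
`Bw βw hβw`, `(G, ιG, hker)`, `(βG, hβG)`) together with the `A`-side reading `ιA : G ⟶ A`, «`t ∈ A(T)` killed by every `ι(r)`, `r ∈ w` ⟺ `t` factors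
through `ιA`», and `O`-equivariance.  The two sockets left to GEN are (S-H) the block height (`hrank`) and (S-T) the Lie signature (kit's `htan`∕`hdim`,
read through ★ DEAL 1∕DEAL 2 — not typed here).  HC_CM is proved only modulo the printed citations until rung 0 closes; nothing here is about HC.

THE MATHEMATICS.  `A → Spec k` an abelian scheme (commutative group law, relative dimension `g`) with a ring action `act : O → End(A)`, `p ≠ 0`,
`w` a maximal ideal of `O` with `(p) = w^e · 𝔟`, `w + 𝔟 = (1)`, `e > 0`, `p ∈ w`; `a : ℕ → O` a block idempotent family at `w` (`a_n ≡ 1 mod w^{en}`,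
`a_n ∈ 𝔟^n`; ★ (O-CRT)).  Then ([Tate1967] §2 (2.1)–(2.2); [RapoportSmithlingZhang2020Diagonal] §4.1 p. 17: «`A[p^∞] = ∏_{w∣p} A[w^∞]`, `A[w^∞]`
a Barsotti–Tate `𝒪_{F,w}`-module») §1: `ε_w := β(a)` is an idempotent endomorphism of `A[p^∞]` and the local ring `O_w` acts on `Bw := Fix ε_w` (★
(O-LOC) HEAD, with the inverse families and the absorption `w^{en}·a_n ⊆ (pⁿ)` of ★ (O-CRT)), `𝔪_w^{en}` killing the `n`-th layer; §2: for any ring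
action `βw` on a BT group and `ϖ`, the kernel `G := Ker (βw ϖ)_n` is a finite (affine) closed subgroup of the layer, with the kernel universal property on
points, stable under every `βw c` (commutativity), whence `βG`; §3: with `ιA := ιG ≫ ι₁ ≫ (A[p] ↪ A)` (a homomorphic closed immersion), a `T`-point of
`A` is killed by `w` iff it factors through `ιA` (★ (O-J) §5: it lies in `A[p]`; §3: in `(Fix ε)₁` and killed by `ϖ`; §2: in `G`), and `βG(r∕1) ≫ ιA = ιA ≫ ι(r)`
(★ (O-LOC) `βw ∘ algebraMap = β|_{Fix}`, ★ DEAL 3 `(ι r)[p^∞]₁ ≫ (A[p] ↪ A) = (A[p] ↪ A) ≫ ι r`).  §4 packages §1–§3.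

* §1 `exists_blockAction` (★ (O-LOC) HEAD fed by ★ (O-CRT)); §2 (generic) `isClosedImmersion_kerι_app_left`, `isFinite_ker_app_hom`,
  `isAffine_ker_app_left`, `comp_app_eq_one_iff_exists_comp_kerι`, `app_comp_app_comm`, `kerι_comp_app_comp_app_eq_one`, **`exists_kerAction`**;
  §3 `sub_one_mem_of_pos`, `isMonHom_ιA`, `isClosedImmersion_ιA_left`, **`comp_ιA_eq_ιA_comp_i`**, **`forall_mem_comp_i_eq_one_iff_exists_comp_ιA`**;
  §4 HEAD **`exists_blockDocking`**.

LEAN NOTE.  `(A.pDivisibleGroup hp hg).G 1` is `A.torsion (p ^ 1)` by `rfl` but `rw` does not match across this seam (§3 names it `i₁`).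

## References
* [Tate1967] J. T. Tate, *p-divisible groups*, Proc. Conf. Local Fields (Driebergen, 1966), Springer (1967), §2 (2.1)–(2.2).
* [RapoportSmithlingZhang2020Diagonal] M. Rapoport, B. Smithling, W. Zhang, *Arithmetic diagonal cycles on unitary Shimura varieties*, Compos. Math. 156
  (2020), §4.1 (p. 17).
* [HarrisTaylorAMS2001] M. Harris, R. Taylor, *The geometry and cohomology of some simple Shimura varieties*, Ann. of Math. Stud. 151 (2001), §II.1 (p. 59).
* [Liu2021] Y. Liu, *Fourier–Jacobi cycles and arithmetic relative trace formula* (2021), Appendix D (p. 136); [Neukirch1999] Ch. I §3 (3.6), §11 (11.5).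
* [GortzWedhorn2020] U. Görtz, T. Wedhorn, *Algebraic Geometry I* (2nd ed. 2020), Definition 4.45 (2) (p. 117) (kernels as fibre products).
-/

set_option autoImplicit false

noncomputable section

universe u v

open CategoryTheory CategoryTheory.Limits AlgebraicGeometry MonoidalCategory CartesianMonoidalCategory
open scoped MonObj

namespace Literature.AlgebraicGeometry.AbelianSchemes.AbelianSchemeOver.RingAction

open Literature.AlgebraicGeometry.GroupSchemes Literature.AlgebraicGeometry.GroupSchemes.GroupSchemeKernel
open Literature.AlgebraicGeometry.GroupSchemes.BTGroup Literature.AlgebraicGeometry.GroupSchemes.BTGroup.Hom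
open Literature.AlgebraicGeometry.GroupSchemes.IsRingActionBT
open Literature.RingTheory.DedekindDomain

section Block

variable {k : Type u} [Field k] {p : ℕ} {A : AbelianSchemeOver (Spec (.of k))} [IsCommMonObj A.X] {g : ℕ} (hp : p ≠ 0)
  (hg : A.IsOfRelDim g) {O : Type v} [CommRing O] (act : RingAction O A)
  (w : Ideal O) [w.IsMaximal] {e : ℕ} {𝔟 : Ideal O} (hx : Ideal.span {(p : O)} = w ^ e * 𝔟) (hcop : w ⊔ 𝔟 = ⊤)
  (a : ℕ → O) (ha1 : ∀ n, a n - 1 ∈ w ^ (e * n)) (ha2 : ∀ n, a n ∈ 𝔟 ^ n) (h₁ : ℕ)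
  (hrank : ∀ n (s : Spec (.of k)),
    (((isRingActionBT_pDivisibleGroupMap act hp hg).homOfCompatibleFamily a
      (sub_mem_span_pow hx hcop ha1 ha2)).fixLayer n).hom.finrank s = p ^ (n * h₁))

/-! ### §1 The `w`-block `Bw := Fix ε_w` of `A[p^∞]` and the action of `O_w` on it -/

/-- **§1 — THE `w`-BLOCK AND ITS `O_w`-ACTION.**  `ε_w := β(a)` (`β r := (act.i r)[p^∞]`, ★ DEAL 3) is an idempotent endomorphism of `A[p^∞]`;
given its rank function `hrank` (socket (S-H)), `Bw := Fix ε_w` is a Barsotti–Tate group on which the local ring `O_w = Localization.AtPrime w` acts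
(`IsRingActionBT`), extending the restricted action of `O` and with `𝔪_w^{en}` trivial on the `n`-th layer — ★ (O-LOC)
`IsRingActionBT.exists_isRingActionBT_localization` with the inverse families ★ `BlockIdempotentFamily.exists_inverseFamily` and the absorption ★
`mul_mem_span_pow_of_mem_pow` of ★ (O-CRT). [cite: Tate1967, §2 (2.1)–(2.2)] [cite: RapoportSmithlingZhang2020Diagonal, §4.1 (p. 17)]
[cite: HarrisTaylorAMS2001, §II.1 (p. 59)] -/
theorem exists_blockAction :
    ∃ βw : Localization.AtPrime w →
        BTGroup.Hom
          (((isRingActionBT_pDivisibleGroupMap act hp hg).homOfCompatibleFamily a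
              (sub_mem_span_pow hx hcop ha1 ha2)).fixBTGroup
            ((isRingActionBT_pDivisibleGroupMap act hp hg).homOfCompatibleFamily_idem a
              (sub_mem_span_pow hx hcop ha1 ha2) (mul_self_sub_mem_span_pow hx hcop ha1 ha2))
            h₁ hrank)
          (((isRingActionBT_pDivisibleGroupMap act hp hg).homOfCompatibleFamily a
              (sub_mem_span_pow hx hcop ha1 ha2)).fixBTGroup
            ((isRingActionBT_pDivisibleGroupMap act hp hg).homOfCompatibleFamily_idem a
              (sub_mem_span_pow hx hcop ha1 ha2) (mul_self_sub_mem_span_pow hx hcop ha1 ha2))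
            h₁ hrank),
      IsRingActionBT _ βw ∧
      (∀ r : O, βw (algebraMap O (Localization.AtPrime w) r) =
        fixRestrict _ _ h₁ hrank _ _ h₁ hrank
          (haveI := act.isMonHom_i r; pDivisibleGroupMap (act.i r) hp hg hg)
          ((isRingActionBT_pDivisibleGroupMap act hp hg).app_comp_homOfCompatibleFamily_app a
            (sub_mem_span_pow hx hcop ha1 ha2) r)) ∧
      ∀ n, ∀ b ∈ (IsLocalRing.maximalIdeal (Localization.AtPrime w)) ^ (e * n), (βw b).app n =
        (letI := (((isRingActionBT_pDivisibleGroupMap act hp hg).homOfCompatibleFamily a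
              (sub_mem_span_pow hx hcop ha1 ha2)).fixBTGroup
            ((isRingActionBT_pDivisibleGroupMap act hp hg).homOfCompatibleFamily_idem a
              (sub_mem_span_pow hx hcop ha1 ha2) (mul_self_sub_mem_span_pow hx hcop ha1 ha2))
            h₁ hrank).grpObj n; 1) :=
  exists_isRingActionBT_localization (isRingActionBT_pDivisibleGroupMap act hp hg) a
    (sub_mem_span_pow hx hcop ha1 ha2) (mul_self_sub_mem_span_pow hx hcop ha1 ha2) h₁ hrank w
    (fun s hs => exists_inverseFamily hx hcop inferInstance ha1 ha2 s hs) e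
    (fun n _ hb => mul_mem_span_pow_of_mem_pow hx hcop ha2 n hb)

end Block


end Literature.AlgebraicGeometry.AbelianSchemes.AbelianSchemeOver.RingAction

/-! ### §2 The kit socket of a Barsotti–Tate group with a ring action: `G := Ker (βw ϖ)_n`, its inclusion, its points, and the induced action -/

namespace Literature.AlgebraicGeometry.GroupSchemes.IsRingActionBT

open BTGroup BTGroup.Hom GroupSchemeKernel

section Socket

variable {k : Type u} [Field k] {p H : ℕ} {B : BTGroup (Spec (.of k)) p H} {Rw : Type v} [CommRing Rw] {βw : Rw → BTGroup.Hom B B}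
  (hβw : IsRingActionBT B βw) (ϖ : Rw) (n : ℕ)

omit [CommRing Rw] in
/-- The kernel `Ker (βw ϖ)_n ↪ B_n` is a closed immersion (the layer is finite over the field, hence separated). [cite: GortzWedhorn2020, Definition 4.45 (2) (p. 117)]
[cite: Tate1967, §2 (2.1)] -/
theorem isClosedImmersion_kerι_app_left :
    letI := B.grpObj n; IsClosedImmersion (kerι ((βw ϖ).app n)).left := by
  letI := B.grpObj n
  haveI : IsFinite (B.G n).hom := B.isFinite n
  exact isClosedImmersion_kerι_left_of_isSeparated _

omit [CommRing Rw] in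
/-- `Ker (βw ϖ)_n → Spec k` is finite (closed in the finite layer). [cite: Tate1967, §2 (2.1)] [cite: GortzWedhorn2020, Definition 4.45 (2) (p. 117)] -/
theorem isFinite_ker_app_hom :
    letI := B.grpObj n; IsFinite (ker ((βw ϖ).app n)).hom := by
  letI := B.grpObj n
  haveI : IsFinite (B.G n).hom := B.isFinite n
  haveI := isClosedImmersion_kerι_app_left (βw := βw) ϖ n
  have h : (ker ((βw ϖ).app n)).hom = (kerι ((βw ϖ).app n)).left ≫ (B.G n).hom := (Over.w (kerι ((βw ϖ).app n))).symm
  rw [h]; infer_instance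

omit [CommRing Rw] in
/-- `Ker (βw ϖ)_n` is affine. [cite: Tate1967, §2 (2.1)] -/
theorem isAffine_ker_app_left :
    letI := B.grpObj n; IsAffine (ker ((βw ϖ).app n)).left := by
  letI := B.grpObj n
  haveI := isFinite_ker_app_hom (βw := βw) ϖ n
  exact AffineGroupScheme.isAffine_left_of_isAffineHom (ker ((βw ϖ).app n))

omit [CommRing Rw] in
/-- **The kit socket `hker`**: a `T`-point of the layer is killed by `(βw ϖ)_n` iff it factors through `ιG := kerι` (★ kernel universal property).
[cite: GortzWedhorn2020, Definition 4.45 (2) (p. 117)] [cite: Tate1967, §2 (2.1)] -/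
theorem comp_app_eq_one_iff_exists_comp_kerι {T : Over (Spec (.of k))} (t : T ⟶ B.G n) :
    letI := B.grpObj n; t ≫ (βw ϖ).app n = 1 ↔ ∃ s : T ⟶ ker ((βw ϖ).app n), s ≫ kerι ((βw ϖ).app n) = t := by
  letI := B.grpObj n
  constructor
  · intro ht
    exact ⟨kerLift t ht, kerLift_ι t ht⟩
  · rintro ⟨s, rfl⟩
    rw [Category.assoc, kerι_comp, MonObj.comp_one]

include hβw in
/-- A ring action of a COMMUTATIVE ring acts by commuting endomorphisms on every layer (`βw (cd) = βw d ∘ βw c = βw (dc)`).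
[cite: Tate1967, §2 (2.2)] -/
theorem app_comp_app_comm (c d : Rw) : (βw c).app n ≫ (βw d).app n = (βw d).app n ≫ (βw c).app n := by
  rw [← comp_app, ← comp_app, ← hβw.map_mul, ← hβw.map_mul, mul_comm]

include hβw in
/-- `βw c` maps `Ker (βw ϖ)_n` into itself: `(ιG ≫ (βw c)_n) ≫ (βw ϖ)_n = 1`. [cite: Tate1967, §2 (2.2)] [cite: GortzWedhorn2020, Definition 4.45 (2) (p. 117)] -/
theorem kerι_comp_app_comp_app_eq_one (c : Rw) :
    letI := B.grpObj n; (kerι ((βw ϖ).app n) ≫ (βw c).app n) ≫ (βw ϖ).app n = 1 := by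
  letI := B.grpObj n
  haveI := (βw c).isMonHom_app n
  rw [Category.assoc, hβw.app_comp_app_comm n c ϖ, ← Category.assoc, kerι_comp, MonObj.one_comp]

include hβw in
/-- **The kit socket `(βG, hβG)`**: the action restricts to the kernel — homomorphisms `βG c : G ⟶ G` with `βG c ≫ ιG = ιG ≫ (βw c)_n` (★ `kerLift`,
★ `isMonHom_kerLift`). [cite: Tate1967, §2 (2.2)] [cite: GortzWedhorn2020, Definition 4.45 (2) (p. 117)] -/
theorem exists_kerAction :
    letI := B.grpObj n
    haveI := (βw ϖ).isMonHom_app n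
    ∃ βG : Rw → (ker ((βw ϖ).app n) ⟶ ker ((βw ϖ).app n)),
      (∀ c, βG c ≫ kerι ((βw ϖ).app n) = kerι ((βw ϖ).app n) ≫ (βw c).app n) ∧ ∀ c, IsMonHom (βG c) := by
  letI := B.grpObj n
  haveI := (βw ϖ).isMonHom_app n
  refine ⟨fun c => kerLift (kerι ((βw ϖ).app n) ≫ (βw c).app n) (hβw.kerι_comp_app_comp_app_eq_one ϖ n c),
    fun c => kerLift_ι _ _, fun c => ?_⟩
  haveI := (βw c).isMonHom_app n
  exact isMonHom_kerLift _ _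

end Socket

end Literature.AlgebraicGeometry.GroupSchemes.IsRingActionBT

/-! ### §3 The `A`-side: `ιA : G ⟶ A`, its points («killed by every `r ∈ w`») and its `O`-equivariance -/

namespace Literature.AlgebraicGeometry.AbelianSchemes.AbelianSchemeOver.RingAction

open Literature.AlgebraicGeometry.GroupSchemes Literature.AlgebraicGeometry.GroupSchemes.GroupSchemeKernel
open Literature.AlgebraicGeometry.GroupSchemes.BTGroup Literature.AlgebraicGeometry.GroupSchemes.BTGroup.Hom
open Literature.AlgebraicGeometry.GroupSchemes.IsRingActionBT
open Literature.RingTheory.DedekindDomain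

/-- Composition of homomorphisms with the `MonObj` structures as implicit (non-instance) arguments — term-mode glue for structures that are only
definitionally the instances found by class resolution (`(A[p^∞])₁` vs `A[p]`). [folklore] -/
private theorem isMonHom_comp_of_isMonHom {C : Type*} [Category C] [CartesianMonoidalCategory C] {M N N' : C} {iM : MonObj M} {iN : MonObj N}
    {iN' : MonObj N'} {f : M ⟶ N} {g' : N ⟶ N'} (hf : IsMonHom f) (hg : IsMonHom g') : IsMonHom (f ≫ g') :=
  instIsMonHomComp f g'

section ASide

variable {k : Type u} [Field k] {p : ℕ} {A : AbelianSchemeOver (Spec (.of k))} [IsCommMonObj A.X] {g : ℕ} (hp : p ≠ 0)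
  (hg : A.IsOfRelDim g) {O : Type v} [CommRing O] (act : RingAction O A)
  (w : Ideal O) {e : ℕ} {𝔟 : Ideal O} (hx : Ideal.span {(p : O)} = w ^ e * 𝔟) (hcop : w ⊔ 𝔟 = ⊤)
  (a : ℕ → O) (ha1 : ∀ n, a n - 1 ∈ w ^ (e * n)) (ha2 : ∀ n, a n ∈ 𝔟 ^ n) (h₁ : ℕ)
  (hrank : ∀ n (s : Spec (.of k)), (((isRingActionBT_pDivisibleGroupMap act hp hg).homOfCompatibleFamily a (sub_mem_span_pow hx hcop ha1 ha2)).fixLayer n).hom.finrank s = p ^ (n * h₁))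

include ha1 in
/-- If `e > 0`, a block idempotent family has `a 1 ≡ 1 (mod w)` (`a 1 − 1 ∈ w^e ⊆ w`) — the hypothesis `h1w` of ★ (O-J).
[cite: Neukirch1999, Ch. I §3 (3.6)] -/
theorem sub_one_mem_of_pos (he : 0 < e) : a 1 - 1 ∈ w := by
  have h := ha1 1
  rw [mul_one] at h
  exact Ideal.pow_le_self he.ne' h

/-! #### The composite `ιA : G ⟶ (Fix ε)₁ ⟶ A[p] ⟶ A` for an action `βw` of any ring `Rw` on the block -/

section Generic

variable {Rw : Type*} (βw : Rw → BTGroup.Hom (((isRingActionBT_pDivisibleGroupMap act hp hg).homOfCompatibleFamily a (sub_mem_span_pow hx hcop ha1 ha2)).fixBTGroup ((isRingActionBT_pDivisibleGroupMap act hp hg).homOfCompatibleFamily_idem a (sub_mem_span_pow hx hcop ha1 ha2) (mul_self_sub_mem_span_pow hx hcop ha1 ha2)) h₁ hrank) (((isRingActionBT_pDivisibleGroupMap act hp hg).homOfCompatibleFamily a (sub_mem_span_pow hx hcop ha1 ha2)).fixBTGroup ((isRingActionBT_pDivisibleGroupMap act hp hg).homOfCompatibleFamily_idem a (sub_mem_span_pow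 hx hcop ha1 ha2) (mul_self_sub_mem_span_pow hx hcop ha1 ha2)) h₁ hrank)) (ϖ : Rw)

/-- `ιA := ιG ≫ ι₁ ≫ (A[p] ↪ A) : G ⟶ A` is a HOMOMORPHISM (each factor is: ★ `isMonHom_kerι`, ★ `fixBTGroupι`, ★ `isMonHom_torsionι`).
[cite: Tate1967, §2 (2.1)] [cite: GortzWedhorn2020, Definition 4.45 (2) (p. 117)] -/
theorem isMonHom_ιA :
    letI := (((isRingActionBT_pDivisibleGroupMap act hp hg).homOfCompatibleFamily a (sub_mem_span_pow hx hcop ha1 ha2)).fixBTGroup ((isRingActionBT_pDivisibleGroupMap act hp hg).homOfCompatibleFamily_idem a (sub_mem_span_pow hx hcop ha1 ha2) (mul_self_sub_mem_span_pow hx hcop ha1 ha2)) h₁ hrank).grpObj 1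
    haveI := (βw ϖ).isMonHom_app 1
    IsMonHom (kerι ((βw ϖ).app 1) ≫ (((isRingActionBT_pDivisibleGroupMap act hp hg).homOfCompatibleFamily a (sub_mem_span_pow hx hcop ha1 ha2)).fixBTGroupι ((isRingActionBT_pDivisibleGroupMap act hp hg).homOfCompatibleFamily_idem a (sub_mem_span_pow hx hcop ha1 ha2) (mul_self_sub_mem_span_pow hx hcop ha1 ha2)) h₁ hrank).app 1 ≫ A.torsionι (p ^ 1)) := by
  letI := (((isRingActionBT_pDivisibleGroupMap act hp hg).homOfCompatibleFamily a (sub_mem_span_pow hx hcop ha1 ha2)).fixBTGroup ((isRingActionBT_pDivisibleGroupMap act hp hg).homOfCompatibleFamily_idem a (sub_mem_span_pow hx hcop ha1 ha2) (mul_self_sub_mem_span_pow hx hcop ha1 ha2)) h₁ hrank).grpObj 1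
  haveI := (βw ϖ).isMonHom_app 1
  exact isMonHom_comp_of_isMonHom inferInstance
    (isMonHom_comp_of_isMonHom ((((isRingActionBT_pDivisibleGroupMap act hp hg).homOfCompatibleFamily a (sub_mem_span_pow hx hcop ha1 ha2)).fixBTGroupι ((isRingActionBT_pDivisibleGroupMap act hp hg).homOfCompatibleFamily_idem a (sub_mem_span_pow hx hcop ha1 ha2) (mul_self_sub_mem_span_pow hx hcop ha1 ha2)) h₁ hrank).isMonHom_app 1) (A.isMonHom_torsionι (p ^ 1)))

/-- `ιA : G ⟶ A` is a CLOSED IMMERSION on underlying schemes (kernel in a separated layer, ★ `isClosedImmersion_fixι_left`, ★ `isClosedImmersion_torsionι_left`).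
[cite: Tate1967, §2 (2.1)] [cite: GortzWedhorn2020, Definition 4.45 (2) (p. 117)] -/
theorem isClosedImmersion_ιA_left :
    letI := (((isRingActionBT_pDivisibleGroupMap act hp hg).homOfCompatibleFamily a (sub_mem_span_pow hx hcop ha1 ha2)).fixBTGroup ((isRingActionBT_pDivisibleGroupMap act hp hg).homOfCompatibleFamily_idem a (sub_mem_span_pow hx hcop ha1 ha2) (mul_self_sub_mem_span_pow hx hcop ha1 ha2)) h₁ hrank).grpObj 1
    IsClosedImmersion (kerι ((βw ϖ).app 1) ≫ (((isRingActionBT_pDivisibleGroupMap act hp hg).homOfCompatibleFamily a (sub_mem_span_pow hx hcop ha1 ha2)).fixBTGroupι ((isRingActionBT_pDivisibleGroupMap act hp hg).homOfCompatibleFamily_idem a (sub_mem_span_pow hx hcop ha1 ha2) (mul_self_sub_mem_span_pow hx hcop ha1 ha2)) h₁ hrank).app 1 ≫ A.torsionι (p ^ 1)).left := by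
  letI := (((isRingActionBT_pDivisibleGroupMap act hp hg).homOfCompatibleFamily a (sub_mem_span_pow hx hcop ha1 ha2)).fixBTGroup ((isRingActionBT_pDivisibleGroupMap act hp hg).homOfCompatibleFamily_idem a (sub_mem_span_pow hx hcop ha1 ha2) (mul_self_sub_mem_span_pow hx hcop ha1 ha2)) h₁ hrank).grpObj 1
  have h1 := isClosedImmersion_kerι_app_left (βw := βw) ϖ 1
  have h2 : IsClosedImmersion ((((isRingActionBT_pDivisibleGroupMap act hp hg).homOfCompatibleFamily a (sub_mem_span_pow hx hcop ha1 ha2)).fixBTGroupι ((isRingActionBT_pDivisibleGroupMap act hp hg).homOfCompatibleFamily_idem a (sub_mem_span_pow hx hcop ha1 ha2) (mul_self_sub_mem_span_pow hx hcop ha1 ha2)) h₁ hrank).app 1).left := by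
    letI := (A.pDivisibleGroup hp hg).grpObj 1
    haveI : IsFinite ((A.pDivisibleGroup hp hg).G 1).hom := (A.pDivisibleGroup hp hg).isFinite 1
    exact IdempotentSplitting.isClosedImmersion_fixι_left (((isRingActionBT_pDivisibleGroupMap act hp hg).homOfCompatibleFamily a (sub_mem_span_pow hx hcop ha1 ha2)).app 1)
  have h3 := A.isClosedImmersion_torsionι_left (p ^ 1)
  change IsClosedImmersion ((kerι ((βw ϖ).app 1)).left ≫ ((((isRingActionBT_pDivisibleGroupMap act hp hg).homOfCompatibleFamily a (sub_mem_span_pow hx hcop ha1 ha2)).fixBTGroupι ((isRingActionBT_pDivisibleGroupMap act hp hg).homOfCompatibleFamily_idem a (sub_mem_span_pow hx hcop ha1 ha2) (mul_self_sub_mem_span_pow hx hcop ha1 ha2)) h₁ hrank).app 1).left ≫ (A.torsionι (p ^ 1)).left)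
  exact MorphismProperty.comp_mem _ _ _ h1 (MorphismProperty.comp_mem _ _ _ h2 h3)

variable [CommRing Rw] [Algebra O Rw]
  (hβwR : ∀ r : O, βw (algebraMap O Rw r) =
    fixRestrict _ _ h₁ hrank _ _ h₁ hrank (haveI := act.isMonHom_i r; pDivisibleGroupMap (act.i r) hp hg hg)
      ((isRingActionBT_pDivisibleGroupMap act hp hg).app_comp_homOfCompatibleFamily_app a (sub_mem_span_pow hx hcop ha1 ha2) r))

include hβwR in
/-- **`O`-EQUIVARIANCE OF `ιA`**: for any `βG` over the action (`βG c ≫ ιG = ιG ≫ (βw c)₁`) and `r ∈ O`, `βG (r∕1) ≫ ιA = ιA ≫ act.i r` — ★ (O-LOC)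
`βw (r∕1) = β(r)|_{Fix ε}` (`hβwR`, ★ `fixRestrict_app_comp_fixLayerι`) and ★ DEAL 3 `pDivisibleGroupMap_i_app_comp_ι` (`(ι r)[p^∞]₁ ≫ (A[p] ↪ A) =
(A[p] ↪ A) ≫ ι r`).  Stated for an action `βw` of any `O`-algebra `Rw` on the block. [cite: Tate1967, §2 (2.2)] [cite: RapoportSmithlingZhang2020Diagonal, §4.1 (p. 17)] -/
theorem comp_ιA_eq_ιA_comp_i {βG : Rw → (letI := (((isRingActionBT_pDivisibleGroupMap act hp hg).homOfCompatibleFamily a (sub_mem_span_pow hx hcop ha1 ha2)).fixBTGroup ((isRingActionBT_pDivisibleGroupMap act hp hg).homOfCompatibleFamily_idem a (sub_mem_span_pow hx hcop ha1 ha2) (mul_self_sub_mem_span_pow hx hcop ha1 ha2)) h₁ hrank).grpObj 1; ker ((βw ϖ).app 1) ⟶ ker ((βw ϖ).app 1))}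
    (hβG : letI := (((isRingActionBT_pDivisibleGroupMap act hp hg).homOfCompatibleFamily a (sub_mem_span_pow hx hcop ha1 ha2)).fixBTGroup ((isRingActionBT_pDivisibleGroupMap act hp hg).homOfCompatibleFamily_idem a (sub_mem_span_pow hx hcop ha1 ha2) (mul_self_sub_mem_span_pow hx hcop ha1 ha2)) h₁ hrank).grpObj 1; ∀ c, βG c ≫ kerι ((βw ϖ).app 1) = kerι ((βw ϖ).app 1) ≫ (βw c).app 1) (r : O) :
    letI := (((isRingActionBT_pDivisibleGroupMap act hp hg).homOfCompatibleFamily a (sub_mem_span_pow hx hcop ha1 ha2)).fixBTGroup ((isRingActionBT_pDivisibleGroupMap act hp hg).homOfCompatibleFamily_idem a (sub_mem_span_pow hx hcop ha1 ha2) (mul_self_sub_mem_span_pow hx hcop ha1 ha2)) h₁ hrank).grpObj 1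
    βG (algebraMap O Rw r) ≫ (kerι ((βw ϖ).app 1) ≫ (((isRingActionBT_pDivisibleGroupMap act hp hg).homOfCompatibleFamily a (sub_mem_span_pow hx hcop ha1 ha2)).fixBTGroupι ((isRingActionBT_pDivisibleGroupMap act hp hg).homOfCompatibleFamily_idem a (sub_mem_span_pow hx hcop ha1 ha2) (mul_self_sub_mem_span_pow hx hcop ha1 ha2)) h₁ hrank).app 1 ≫ A.torsionι (p ^ 1)) =
      (kerι ((βw ϖ).app 1) ≫ (((isRingActionBT_pDivisibleGroupMap act hp hg).homOfCompatibleFamily a (sub_mem_span_pow hx hcop ha1 ha2)).fixBTGroupι ((isRingActionBT_pDivisibleGroupMap act hp hg).homOfCompatibleFamily_idem a (sub_mem_span_pow hx hcop ha1 ha2) (mul_self_sub_mem_span_pow hx hcop ha1 ha2)) h₁ hrank).app 1 ≫ A.torsionι (p ^ 1)) ≫ act.i r := by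
  letI := (((isRingActionBT_pDivisibleGroupMap act hp hg).homOfCompatibleFamily a (sub_mem_span_pow hx hcop ha1 ha2)).fixBTGroup ((isRingActionBT_pDivisibleGroupMap act hp hg).homOfCompatibleFamily_idem a (sub_mem_span_pow hx hcop ha1 ha2) (mul_self_sub_mem_span_pow hx hcop ha1 ha2)) h₁ hrank).grpObj 1
  haveI := act.isMonHom_i r
  -- read `torsionι` as a morphism out of the first layer `(A[p^∞])₁` (= `A[p]` definitionally), so that all seams match syntactically
  obtain ⟨i₁, hi₁⟩ : ∃ i₁ : (A.pDivisibleGroup hp hg).G 1 ⟶ A.X, i₁ = A.torsionι (p ^ 1) := ⟨_, rfl⟩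
  have sq1 : (βw (algebraMap O Rw r)).app 1 ≫ (((isRingActionBT_pDivisibleGroupMap act hp hg).homOfCompatibleFamily a (sub_mem_span_pow hx hcop ha1 ha2)).fixBTGroupι ((isRingActionBT_pDivisibleGroupMap act hp hg).homOfCompatibleFamily_idem a (sub_mem_span_pow hx hcop ha1 ha2) (mul_self_sub_mem_span_pow hx hcop ha1 ha2)) h₁ hrank).app 1 = (((isRingActionBT_pDivisibleGroupMap act hp hg).homOfCompatibleFamily a (sub_mem_span_pow hx hcop ha1 ha2)).fixBTGroupι ((isRingActionBT_pDivisibleGroupMap act hp hg).homOfCompatibleFamily_idem a (sub_mem_span_pow hx hcop ha1 ha2) (mul_self_sub_mem_span_pow hx hcop ha1 ha2)) h₁ hrank).app 1 ≫ (pDivisibleGroupMap (act.i r) hp hg hg).app 1 := by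
    rw [hβwR r, fixBTGroupι_app, fixRestrict_app_comp_fixLayerι]
    rfl
  have sq2 : (pDivisibleGroupMap (act.i r) hp hg hg).app 1 ≫ i₁ = i₁ ≫ act.i r := by
    subst hi₁
    exact pDivisibleGroupMap_i_app_comp_ι act hp hg r 1
  rw [← hi₁, ← Category.assoc (βG _), hβG, Category.assoc, ← Category.assoc ((βw _).app 1), sq1, Category.assoc, sq2]
  simp only [Category.assoc]

end Generic

/-! #### The points of `ιA`: «killed by every `r ∈ w`» (for the localised action `βw` of `R_w`) -/

section Local

variable [w.IsPrime] (βw : Localization.AtPrime w → BTGroup.Hom (((isRingActionBT_pDivisibleGroupMap act hp hg).homOfCompatibleFamily a (sub_mem_span_pow hx hcop ha1 ha2)).fixBTGroup ((isRingActionBT_pDivisibleGroupMap act hp hg).homOfCompatibleFamily_idem a (sub_mem_span_pow hx hcop ha1 ha2) (mul_self_sub_mem_span_pow hx hcop ha1 ha2)) h₁ hrank) (((isRingActionBT_pDivisibleGroupMap act hp hg).homOfCompatibleFamily a (sub_mem_span_pow hx hcop ha1 ha2)).fixBTGroup ((isRingActionBT_pDivisibleGroupMap act hp hg).homOfCompatibleFamily_idem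 a (sub_mem_span_pow hx hcop ha1 ha2) (mul_self_sub_mem_span_pow hx hcop ha1 ha2)) h₁ hrank)) (hβw : IsRingActionBT (((isRingActionBT_pDivisibleGroupMap act hp hg).homOfCompatibleFamily a (sub_mem_span_pow hx hcop ha1 ha2)).fixBTGroup ((isRingActionBT_pDivisibleGroupMap act hp hg).homOfCompatibleFamily_idem a (sub_mem_span_pow hx hcop ha1 ha2) (mul_self_sub_mem_span_pow hx hcop ha1 ha2)) h₁ hrank) βw)
  (hβwR : ∀ r : O, βw (algebraMap O (Localization.AtPrime w) r) =
    fixRestrict _ _ h₁ hrank _ _ h₁ hrank (haveI := act.isMonHom_i r; pDivisibleGroupMap (act.i r) hp hg hg)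
      ((isRingActionBT_pDivisibleGroupMap act hp hg).app_comp_homOfCompatibleFamily_app a (sub_mem_span_pow hx hcop ha1 ha2) r))
  (ϖ : Localization.AtPrime w) (hϖ : IsLocalRing.maximalIdeal (Localization.AtPrime w) = Ideal.span {ϖ})

include hβw hβwR hϖ in
/-- **THE POINTS OF `ιA`: «killed by every `r ∈ w`».**  For the localised action `βw` of `O_w` on `Fix ε_w` (★ (O-LOC) output shape: `hβw`, `hβwR`),
`ϖ` a generator of `𝔪_w`, `e > 0` and `p ∈ w`: a `T`-point `t` of `A` satisfies `t ≫ act.i r = 1` for all `r ∈ w` iff it factors through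
`ιA : Ker (βw ϖ)₁ ⟶ (Fix ε_w)₁ ⟶ A[p] ⟶ A` — ★ (O-J) §5 (`t` lies in `A[p]`, since `act.i p = [p]`), ★ (O-J) §3 (in `(Fix ε_w)₁`, killed by `ϖ`; `a 1 ≡ 1
mod w`), then the kernel universal property; and conversely.  This is P6a's `hkerG₀` («`G₀ x̄ = A_x̄[𝔭]`») for the kit's carrier.
[cite: Tate1967, §2 (2.1)–(2.2)] [cite: RapoportSmithlingZhang2020Diagonal, §4.1 (p. 17)] [cite: Liu2021, Appendix D (p. 136)] -/
theorem forall_mem_comp_i_eq_one_iff_exists_comp_ιA (he : 0 < e) (hpw : (p : O) ∈ w) {T : Over (Spec (.of k))} (t : T ⟶ A.X) :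
    letI := (((isRingActionBT_pDivisibleGroupMap act hp hg).homOfCompatibleFamily a (sub_mem_span_pow hx hcop ha1 ha2)).fixBTGroup ((isRingActionBT_pDivisibleGroupMap act hp hg).homOfCompatibleFamily_idem a (sub_mem_span_pow hx hcop ha1 ha2) (mul_self_sub_mem_span_pow hx hcop ha1 ha2)) h₁ hrank).grpObj 1
    (∀ r ∈ w, t ≫ act.i r = 1) ↔
      ∃ s : T ⟶ ker ((βw ϖ).app 1), s ≫ (kerι ((βw ϖ).app 1) ≫ (((isRingActionBT_pDivisibleGroupMap act hp hg).homOfCompatibleFamily a (sub_mem_span_pow hx hcop ha1 ha2)).fixBTGroupι ((isRingActionBT_pDivisibleGroupMap act hp hg).homOfCompatibleFamily_idem a (sub_mem_span_pow hx hcop ha1 ha2) (mul_self_sub_mem_span_pow hx hcop ha1 ha2)) h₁ hrank).app 1 ≫ A.torsionι (p ^ 1)) = t := by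
  letI := (((isRingActionBT_pDivisibleGroupMap act hp hg).homOfCompatibleFamily a (sub_mem_span_pow hx hcop ha1 ha2)).fixBTGroup ((isRingActionBT_pDivisibleGroupMap act hp hg).homOfCompatibleFamily_idem a (sub_mem_span_pow hx hcop ha1 ha2) (mul_self_sub_mem_span_pow hx hcop ha1 ha2)) h₁ hrank).grpObj 1
  have h1w := sub_one_mem_of_pos w a ha1 he
  constructor
  · intro ht
    -- down to the first layer `A[p]` (★ (O-J) §5), then into `Fix ε` killed by `ϖ` (★ (O-J) §3), then into the kernel
    obtain ⟨t₁, ht₁, ht₁w⟩ := exists_torsionLift_forall_comp_app_eq_one act hp hg w hpw t ht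
    obtain ⟨s', hs', hs'ϖ⟩ :=
      (forall_mem_comp_app_eq_one_iff_exists (isRingActionBT_pDivisibleGroupMap act hp hg) a (sub_mem_span_pow hx hcop ha1 ha2) (mul_self_sub_mem_span_pow hx hcop ha1 ha2) h₁ hrank w βw hβw hβwR ϖ hϖ h1w t₁).mp ht₁w
    obtain ⟨s, hs⟩ := (comp_app_eq_one_iff_exists_comp_kerι (βw := βw) ϖ 1 s').mp hs'ϖ
    refine ⟨s, ?_⟩
    rw [← Category.assoc, hs, ← Category.assoc, hs', ht₁]
  · rintro ⟨s, rfl⟩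
    have hs'ϖ : (s ≫ kerι ((βw ϖ).app 1)) ≫ (βw ϖ).app 1 = 1 := by
      rw [Category.assoc, kerι_comp, MonObj.comp_one]
    have h := (forall_mem_iff_comp_app_eq_one (isRingActionBT_pDivisibleGroupMap act hp hg) a (sub_mem_span_pow hx hcop ha1 ha2) (mul_self_sub_mem_span_pow hx hcop ha1 ha2) h₁ hrank w βw hβw hβwR ϖ hϖ (s ≫ kerι ((βw ϖ).app 1))).mpr hs'ϖ
    have h' := forall_comp_torsionι_comp_i_eq_one act hp hg w ((s ≫ kerι ((βw ϖ).app 1)) ≫ (((isRingActionBT_pDivisibleGroupMap act hp hg).homOfCompatibleFamily a (sub_mem_span_pow hx hcop ha1 ha2)).fixBTGroupι ((isRingActionBT_pDivisibleGroupMap act hp hg).homOfCompatibleFamily_idem a (sub_mem_span_pow hx hcop ha1 ha2) (mul_self_sub_mem_span_pow hx hcop ha1 ha2)) h₁ hrank).app 1) h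
    intro r hr
    have h'' := h' r hr
    simpa only [Category.assoc] using h''

end Local

end ASide

/-! ### §4 THE PACKAGE — one `∃` per special point, in `A`-currency -/

section Package

variable {k : Type u} [Field k] {p : ℕ} {A : AbelianSchemeOver (Spec (.of k))} [IsCommMonObj A.X] {g : ℕ} (hp : p ≠ 0)
  (hg : A.IsOfRelDim g) {O : Type v} [CommRing O] (act : RingAction O A)
  (w : Ideal O) [w.IsMaximal] {e : ℕ} {𝔟 : Ideal O} (hx : Ideal.span {(p : O)} = w ^ e * 𝔟) (hcop : w ⊔ 𝔟 = ⊤)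
  (a : ℕ → O) (ha1 : ∀ n, a n - 1 ∈ w ^ (e * n)) (ha2 : ∀ n, a n ∈ 𝔟 ^ n) (h₁ : ℕ)
  (hrank : ∀ n (s : Spec (.of k)), (((isRingActionBT_pDivisibleGroupMap act hp hg).homOfCompatibleFamily a (sub_mem_span_pow hx hcop ha1 ha2)).fixLayer n).hom.finrank s = p ^ (n * h₁))

include hcop ha2 in
/-- **§4 HEAD — THE `w`-BLOCK DOCKING PACKAGE.**  For `A → Spec k` (commutative group law, relative dimension `g`) with a ring action `act` of `O`,
`p ≠ 0`, `w` maximal with `(p) = w^e·𝔟`, `w + 𝔟 = (1)`, `e > 0`, `p ∈ w`, a block idempotent family `a` at `w` (★ (O-CRT) `exists_blockIdempotentFamily`),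
the rank function `hrank` of `Fix ε_w` (socket (S-H)) and a generator `ϖ` of `𝔪_w ⊆ O_w`: THERE EXIST the localised action `βw` on `Bw := Fix ε_w`
(`IsRingActionBT`, extending `β|_{Fix}`, `𝔪_w^{en}` killing layer `n`) and, for `G := Ker (βw ϖ)₁` with `ιG := kerι`: `ιG` a closed immersion, `G` affine
and finite; the socket `hker`; an `O`-action `βG` on `G` over `βw ∘ algebraMap` by homomorphisms; and on the `A`-side, with
`ιA := ιG ≫ ι₁ ≫ (A[p] ↪ A)`: `ιA` is a homomorphic closed immersion, **`(∀ r ∈ w, t ≫ act.i r = 1) ↔ ∃ s, s ≫ ιA = t`** for every `T`-point `t` of `A`,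
and `βG c ≫ ιA = ιA ≫ act.i c`.  (GEN then feeds `Bw βw hβw`, `G ιG hker`, `βG hβG` to the ★ P6b kit `blockNumerics_of_line`, supplying `htan`∕`hdim`
from the Lie signature through ★ DEAL 1∕DEAL 2, and reads the result on `A_x̄` through `ιA`.)
[cite: Tate1967, §2 (2.1)–(2.2)] [cite: RapoportSmithlingZhang2020Diagonal, §4.1 (p. 17)] [cite: HarrisTaylorAMS2001, §II.1 (p. 59)] [cite: Liu2021, Appendix D (p. 136)] -/
theorem exists_blockDocking (he : 0 < e) (hpw : (p : O) ∈ w) (ϖ : Localization.AtPrime w)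
    (hϖ : IsLocalRing.maximalIdeal (Localization.AtPrime w) = Ideal.span {ϖ}) :
    ∃ (βw : Localization.AtPrime w → BTGroup.Hom (((isRingActionBT_pDivisibleGroupMap act hp hg).homOfCompatibleFamily a (sub_mem_span_pow hx hcop ha1 ha2)).fixBTGroup ((isRingActionBT_pDivisibleGroupMap act hp hg).homOfCompatibleFamily_idem a (sub_mem_span_pow hx hcop ha1 ha2) (mul_self_sub_mem_span_pow hx hcop ha1 ha2)) h₁ hrank) (((isRingActionBT_pDivisibleGroupMap act hp hg).homOfCompatibleFamily a (sub_mem_span_pow hx hcop ha1 ha2)).fixBTGroup ((isRingActionBT_pDivisibleGroupMap act hp hg).homOfCompatibleFamily_idem a (sub_mem_span_pow hx hcop ha1 ha2) (mul_self_sub_mem_span_pow hx hcop ha1 ha2)) h₁ hrank)) (_ : IsRingActionBT (((isRingActionBT_pDivisibleGroupMap act hp hg).homOfCompatibleFamily a (sub_mem_span_pow hx hcop ha1 ha2)).fixBTGroup ((isRingActionBT_pDivisibleGroupMap act hp hg).homOfCompatibleFamily_idem a (sub_mem_span_pow hx hcop ha1 ha2) (mul_self_sub_mem_span_pow hx hcop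 ha1 ha2)) h₁ hrank) βw)
      (_ : ∀ r : O, βw (algebraMap O (Localization.AtPrime w) r) =
        fixRestrict _ _ h₁ hrank _ _ h₁ hrank (haveI := act.isMonHom_i r; pDivisibleGroupMap (act.i r) hp hg hg)
          ((isRingActionBT_pDivisibleGroupMap act hp hg).app_comp_homOfCompatibleFamily_app a (sub_mem_span_pow hx hcop ha1 ha2) r))
      (_ : ∀ n, ∀ b ∈ (IsLocalRing.maximalIdeal (Localization.AtPrime w)) ^ (e * n), (βw b).app n = (letI := (((isRingActionBT_pDivisibleGroupMap act hp hg).homOfCompatibleFamily a (sub_mem_span_pow hx hcop ha1 ha2)).fixBTGroup ((isRingActionBT_pDivisibleGroupMap act hp hg).homOfCompatibleFamily_idem a (sub_mem_span_pow hx hcop ha1 ha2) (mul_self_sub_mem_span_pow hx hcop ha1 ha2)) h₁ hrank).grpObj n; 1)),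
      letI := (((isRingActionBT_pDivisibleGroupMap act hp hg).homOfCompatibleFamily a (sub_mem_span_pow hx hcop ha1 ha2)).fixBTGroup ((isRingActionBT_pDivisibleGroupMap act hp hg).homOfCompatibleFamily_idem a (sub_mem_span_pow hx hcop ha1 ha2) (mul_self_sub_mem_span_pow hx hcop ha1 ha2)) h₁ hrank).grpObj 1
      haveI := (βw ϖ).isMonHom_app 1
      (IsClosedImmersion (kerι ((βw ϖ).app 1)).left ∧ IsAffine (ker ((βw ϖ).app 1)).left ∧ IsFinite (ker ((βw ϖ).app 1)).hom) ∧
      (∀ ⦃T : Over (Spec (.of k))⦄ (t : T ⟶ (((isRingActionBT_pDivisibleGroupMap act hp hg).homOfCompatibleFamily a (sub_mem_span_pow hx hcop ha1 ha2)).fixBTGroup ((isRingActionBT_pDivisibleGroupMap act hp hg).homOfCompatibleFamily_idem a (sub_mem_span_pow hx hcop ha1 ha2) (mul_self_sub_mem_span_pow hx hcop ha1 ha2)) h₁ hrank).G 1),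
        t ≫ (βw ϖ).app 1 = 1 ↔ ∃ s : T ⟶ ker ((βw ϖ).app 1), s ≫ kerι ((βw ϖ).app 1) = t) ∧
      ∃ βG : O → (ker ((βw ϖ).app 1) ⟶ ker ((βw ϖ).app 1)),
        (∀ c, βG c ≫ kerι ((βw ϖ).app 1) = kerι ((βw ϖ).app 1) ≫ (βw (algebraMap O (Localization.AtPrime w) c)).app 1) ∧
        (∀ c, IsMonHom (βG c)) ∧
        IsMonHom (kerι ((βw ϖ).app 1) ≫ (((isRingActionBT_pDivisibleGroupMap act hp hg).homOfCompatibleFamily a (sub_mem_span_pow hx hcop ha1 ha2)).fixBTGroupι ((isRingActionBT_pDivisibleGroupMap act hp hg).homOfCompatibleFamily_idem a (sub_mem_span_pow hx hcop ha1 ha2) (mul_self_sub_mem_span_pow hx hcop ha1 ha2)) h₁ hrank).app 1 ≫ A.torsionι (p ^ 1)) ∧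
        IsClosedImmersion (kerι ((βw ϖ).app 1) ≫ (((isRingActionBT_pDivisibleGroupMap act hp hg).homOfCompatibleFamily a (sub_mem_span_pow hx hcop ha1 ha2)).fixBTGroupι ((isRingActionBT_pDivisibleGroupMap act hp hg).homOfCompatibleFamily_idem a (sub_mem_span_pow hx hcop ha1 ha2) (mul_self_sub_mem_span_pow hx hcop ha1 ha2)) h₁ hrank).app 1 ≫ A.torsionι (p ^ 1)).left ∧
        (∀ ⦃T : Over (Spec (.of k))⦄ (t : T ⟶ A.X),
          (∀ r ∈ w, t ≫ act.i r = 1) ↔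
            ∃ s : T ⟶ ker ((βw ϖ).app 1), s ≫ (kerι ((βw ϖ).app 1) ≫ (((isRingActionBT_pDivisibleGroupMap act hp hg).homOfCompatibleFamily a (sub_mem_span_pow hx hcop ha1 ha2)).fixBTGroupι ((isRingActionBT_pDivisibleGroupMap act hp hg).homOfCompatibleFamily_idem a (sub_mem_span_pow hx hcop ha1 ha2) (mul_self_sub_mem_span_pow hx hcop ha1 ha2)) h₁ hrank).app 1 ≫ A.torsionι (p ^ 1)) = t) ∧
        ∀ c, βG c ≫ (kerι ((βw ϖ).app 1) ≫ (((isRingActionBT_pDivisibleGroupMap act hp hg).homOfCompatibleFamily a (sub_mem_span_pow hx hcop ha1 ha2)).fixBTGroupι ((isRingActionBT_pDivisibleGroupMap act hp hg).homOfCompatibleFamily_idem a (sub_mem_span_pow hx hcop ha1 ha2) (mul_self_sub_mem_span_pow hx hcop ha1 ha2)) h₁ hrank).app 1 ≫ A.torsionι (p ^ 1)) =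
          (kerι ((βw ϖ).app 1) ≫ (((isRingActionBT_pDivisibleGroupMap act hp hg).homOfCompatibleFamily a (sub_mem_span_pow hx hcop ha1 ha2)).fixBTGroupι ((isRingActionBT_pDivisibleGroupMap act hp hg).homOfCompatibleFamily_idem a (sub_mem_span_pow hx hcop ha1 ha2) (mul_self_sub_mem_span_pow hx hcop ha1 ha2)) h₁ hrank).app 1 ≫ A.torsionι (p ^ 1)) ≫ act.i c := by
  obtain ⟨βw, hβw, hβwR, hkill⟩ := exists_blockAction hp hg act w hx hcop a ha1 ha2 h₁ hrank
  refine ⟨βw, hβw, hβwR, hkill, ?_⟩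
  letI := (((isRingActionBT_pDivisibleGroupMap act hp hg).homOfCompatibleFamily a (sub_mem_span_pow hx hcop ha1 ha2)).fixBTGroup ((isRingActionBT_pDivisibleGroupMap act hp hg).homOfCompatibleFamily_idem a (sub_mem_span_pow hx hcop ha1 ha2) (mul_self_sub_mem_span_pow hx hcop ha1 ha2)) h₁ hrank).grpObj 1
  haveI := (βw ϖ).isMonHom_app 1
  obtain ⟨βG, hβG, hβGmon⟩ := hβw.exists_kerAction ϖ 1
  refine ⟨⟨isClosedImmersion_kerι_app_left (βw := βw) ϖ 1, isAffine_ker_app_left (βw := βw) ϖ 1,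
      isFinite_ker_app_hom (βw := βw) ϖ 1⟩,
    fun T t => comp_app_eq_one_iff_exists_comp_kerι (βw := βw) ϖ 1 t,
    fun c => βG (algebraMap O (Localization.AtPrime w) c), fun c => hβG _, fun c => hβGmon _,
    isMonHom_ιA hp hg act w hx hcop a ha1 ha2 h₁ hrank βw ϖ,
    isClosedImmersion_ιA_left hp hg act w hx hcop a ha1 ha2 h₁ hrank βw ϖ,
    fun T t => forall_mem_comp_i_eq_one_iff_exists_comp_ιA hp hg act w hx hcop a ha1 ha2 h₁ hrank βw hβw hβwR ϖ hϖ he hpw t,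
    fun c => comp_ιA_eq_ιA_comp_i hp hg act w hx hcop a ha1 ha2 h₁ hrank βw ϖ hβwR hβG c⟩

end Package

end Literature.AlgebraicGeometry.AbelianSchemes.AbelianSchemeOver.RingAction

end
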